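/-
COR-CM (cells pub-hodgecm / pub-hodgecm2, stage 2 of the Hodge ladder) — TEAM hCMisogE, sub-object (I2), σ-PARAMETRIC (ALONG) family form
(hcmisog-lead D3 «σ-parametric»; pin-2 package P2′ `Item6PinMatchAlong.lean` p300221; b28 TRANSPOSITION-AUDIT §T20: the joint S2 supply
display meets TEAM hComp at the pin `σ := conj ∘ ι₁`).  Writer hcmisog-isog-2 = prover-pub-hodgecm2-hcmisog-isog-2-0.  Theorems only;
nothing asserted; HC_CM is NOT proved.
-/
import Summits.HodgeConjecture.CorCM.B01.Transposition.Item6PinMatchDef45BC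
import Literature.NumberTheory.Automorphic.Liu2021.Def45EtaConjugate
import HarnessLib

/-!
# Item (vi) S2, CM side along `σ`: `hCMisogσ` from [Liu 2021] Def. 4.5 (2) (TEAM hCMisogE, (I2) along form)

pin-2's along-junction `Model.faceSupply_of_thm418AsPrinted_pinned_isog_along` (p300221) carries the CM identification binder `hCMisogσ`
at an ARBITRARY pin `σ F ι₁ V Φ : F →+* ℂ` (record `σ := ι₁`; TEAM hComp's `hComp`/`hUnif`/`hAlb` are delivered along `conj ∘ ι₁`,
so the joint display reads the CM side there too — b28 §T20).  The σ-parametric CORE of `Transposition/Item6PinMatchDef45.lean` (p301919,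
`Model.exists_isogeny_isCMTypeRealisation_baseChange_of_det45`, stated for any `σ`) gives it face by face:

* `Model.hCMisogσ_of_det45 (hW) (hdetBC) (D) (σ) (Aμ₀) (iμ₀) (hdim) (hdet45σ) : <EXACTLY hCMisogσ at Aμ := (Aμ₀ …) ⊗_{E,σ} ℂ>` —
  carriers `D`, `σ`, `Aμ₀` («`A_μ` … over `E`», l. 1946), `iμ₀` («`i_μ : M_μ → End_E(A_μ)_ℚ`», l. 1948, RATIONAL); readings `hdim`
  («CM structure», l. 1948) and `hdet45σ` (FIRST BULLET l. 1950 = body of the landed field `Def45.CMDatum.det45` in the presentation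
  `(L, φ, ι) := (F, id, σ F ι₁ V Φ)` of `M'_μ ⊆ ℂ`; READING I1-R1 of `Def45AsPrinted`: `η_μ` is presentation-independent in print);
* `Model.hCMisogσ_of_liu45 (D) (σ) (Aμ₀) (iμ₀) (hdim) (hdet45σ)` — the same with the Hodge comparison and the cotangent base change
  consumed BY NAME (`cotangent_hodge10_comparison_holds`, `det_cotangentMap_baseChange` — tree theorems);
* `Model.hCMisogσ_conj_of_liu45 (D) (Aμ₀) (iμ₀) (hdim) (hdet45)` — AT `σ := conj ∘ ι₁` (package P2′, where TEAM hComp's half lives),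
  from the RECORD readings `hdim`/`hdet45` through `ι₁`: Liu's `η_μ` is the same through `ι₁` and through `conj ∘ ι₁`
  (hcomp-abcm-2's `Def45.eta_starRingEnd_comp`, `Liu2021/Def45EtaConjugate.lean` p306543 — READING I1-R1 proved for this pair), so the joint S2 display and the
  `ι₁`-record display consume ONE set of Liu-data readings.

NOT claimed: that Liu's `A_μ` is constructed; that HC_CM is proved.

References: Y. Liu, arXiv:2102.11518 = Camb. J. Math. 9 (2021), Def. 4.3 (2), Def. 4.5, Prop. 4.6 (1) (FJcycle.tex ll. 1919–1969);
G. Shimura (1998) §5.2, §7.1 Prop. 7, §18.5; H. Lange, Ch. Birkenhake (1992) §1.1; U. Görtz, T. Wedhorn, *Algebraic Geometry I* (2020)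
(6.6.2)–(6.6.3), Rem. 6.12.
-/

noncomputable section

open scoped TensorProduct

namespace Summit.HodgeConjecture.CorCM.Model

open CategoryTheory NumberField
open Literature.AlgebraicGeometry.Motives
open Literature.AlgebraicGeometry.HodgeTheory
open Literature.AlgebraicGeometry.ComplexMultiplication
open Literature.NumberTheory.ComplexMultiplication
open Literature.NumberTheory.Automorphic
open Literature.NumberTheory.Automorphic.IdeleClassGroup
open Literature.NumberTheory.Automorphic.PicardCM
open Literature.NumberTheory.Automorphic.Liu2021

/-- **`hCMisogσ` from [Liu2021] Def. 4.5 (2) AS PRINTED, σ-PARAMETRIC PIN** — EXACTLY the type of the binder `hCMisogσ` of pin-2's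
along-junction `Model.faceSupply_of_thm418AsPrinted_pinned_isog_along` (`Transposition/Item6PinMatchAlong.lean`, p300221) at the `E`-rational
pin ALONG `σ`: `Aμ F ι₁ V Φ D_μ := (Aμ₀ F ι₁ V Φ D_μ) ⊗_{E, σ F ι₁ V Φ} ℂ` (hcmisog-lead D3; the record takes `σ := ι₁`, TEAM hComp's package
P2′ takes `σ := conj ∘ ι₁`).  Same carriers and Liu-data readings as `Model.hCMisogE_of_det45` (p301919), with the presentation of
Def. 4.5's `M'_μ ⊆ ℂ`, `η'_μ`, `η_μ` read through `σ F ι₁ V Φ` instead of `ι₁`: `hdet45σ` = the FIRST BULLET (l. 1950) = body of the landed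
field `Def45.CMDatum.det45` at `ι := σ F ι₁ V Φ` (READING I1-R1 of `Def45AsPrinted`: Liu's `η_μ` does not depend on the presentation; the
typing carries it).  Binders `hW` (Hodge comparison, sub-object (L2)) and `hdetBC` (base change of the cotangent space, (L1b)) as in p301919
— both are TREE THEOREMS now (`cotangent_hodge10_comparison_holds`, `det_cotangentMap_baseChange`), see `hCMisogσ_of_liu45` below.
Proof: the σ-parametric core `exists_isogeny_isCMTypeRealisation_baseChange_of_det45` (p301919) at `σ F ι₁ V Φ`, face by face.
HC_CM is NOT proved; no binder is inhabited here.
[cite: Liu2021, Def. 4.5 (1)–(2) (FJcycle.tex ll. 1939–1951), Def. 4.3 (2) (l. 1919) and §4.1 l. 1928]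
[cite: Shimura1998, §5.2 (pp. 36–37) and §7.1 Prop. 7 (p. 47)] [cite: GortzWedhorn2020, (6.6.2)–(6.6.3) and Remark 6.12] -/
theorem hCMisogσ_of_det45 (hW : cotangent_hodge10_comparison)
    (hdetBC : ∀ (K : Type) [Field K] (L : Type) [Field L] [Algebra K L] (A : AbelianVariety K) (u : A ⟶ A),
      LinearMap.det (AbelianVariety.cotangentMap (A.baseChange L) (AbelianVariety.Hom.baseChange L u)) =
        algebraMap K L (LinearMap.det (AbelianVariety.cotangentMap A u)))
    (D : ∀ (F : CMField) (ι₁ : F →+* ℂ) (_ : HermSpace3 F ι₁) (_ : CMType F), Thm418Data (maximalRealSubfield F) F)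
    (σ : ∀ (F : CMField) (ι₁ : F →+* ℂ) (_ : HermSpace3 F ι₁) (_ : CMType F), F →+* ℂ)
    (Aμ₀ : ∀ (F : CMField) (ι₁ : F →+* ℂ) (V : HermSpace3 F ι₁) (Φ : CMType F), (D F ι₁ V Φ).Obj → AbelianVariety F)
    (iμ₀ : ∀ (F : CMField) (ι₁ : F →+* ℂ) (V : HermSpace3 F ι₁) (Φ : CMType F) (Dμ : (D F ι₁ V Φ).Obj),
      muAlgValueField F (D F ι₁ V Φ).μ →+* (Aμ₀ F ι₁ V Φ Dμ).endAlgebra)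
    (hdim : ∀ (F : CMField) [IsGalois ℚ F], 6 ≤ Module.finrank ℚ F → ∀ (Φ : CMType F) (ι₁ : F →+* ℂ), ι₁ ∈ Φ.1 →
      ∀ (V : HermSpace3 F ι₁) (Dμ : (D F ι₁ V Φ).Obj),
        Module.finrank ℚ (muAlgValueField F (D F ι₁ V Φ).μ) = 2 * (Aμ₀ F ι₁ V Φ Dμ).dim)
    (hdet45σ : ∀ (F : CMField) [IsGalois ℚ F], 6 ≤ Module.finrank ℚ F → ∀ (Φ : CMType F) (ι₁ : F →+* ℂ), ι₁ ∈ Φ.1 →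
      ∀ (V : HermSpace3 F ι₁) (Dμ : (D F ι₁ V Φ).Obj) (x : muAlgValueField F (D F ι₁ V Φ).μ) (M : ℕ)
        (f : End (Aμ₀ F ι₁ V Φ Dμ)), M ≠ 0 →
        iμ₀ F ι₁ V Φ Dμ x =
          algebraMap ℚ (Aμ₀ F ι₁ V Φ Dμ).endAlgebra (M : ℚ)⁻¹ * AbelianVariety.endAlgebra.of (Aμ₀ F ι₁ V Φ Dμ) f →
        LinearMap.det (AbelianVariety.cotangentMap (Aμ₀ F ι₁ V Φ Dμ) f) =
          (M : F) ^ (Aμ₀ F ι₁ V Φ Dμ).dim * Def45.eta (AlgHom.id ℚ F) (σ F ι₁ V Φ) (D F ι₁ V Φ).isConjugateSymplectic x) :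
    ∀ (F : CMField) [IsGalois ℚ F], 6 ≤ Module.finrank ℚ F → ∀ (Φ : CMType F) (ι₁ : F →+* ℂ), ι₁ ∈ Φ.1 →
      ∀ (V : HermSpace3 F ι₁) (Dμ : (D F ι₁ V Φ).Obj),
        haveI := (D F ι₁ V Φ).isConjugateSymplectic.numberField_muAlgValueField
        ∀ e : reflexField ℚ F (algValuedIn (σ F ι₁ V Φ) (D F ι₁ V Φ).cmType.1) →+* muAlgValueField F (D F ι₁ V Φ).μ,
          (∀ k : reflexField ℚ F (algValuedIn (σ F ι₁ V Φ) (D F ι₁ V Φ).cmType.1),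
            ((e k : muAlgValueField F (D F ι₁ V Φ).μ) : ℂ) = σ F ι₁ V Φ k) →
          ∃ (B : AbelianVariety ℂ) (g : (letI := (σ F ι₁ V Φ).toAlgebra; (Aμ₀ F ι₁ V Φ Dμ).baseChange ℂ) ⟶ B),
            AbelianVariety.IsIsogeny g ∧
            ∃ (ιB : 𝓞 (muAlgValueField F (D F ι₁ V Φ).μ) →+* End B)
              (θB : muAlgValueField F (D F ι₁ V Φ).μ →+* Module.End ℂ (complexBetti B.X 1)),
              IsCMTypeRealisation (inducedCMType e (reflexCMType (σ F ι₁ V Φ) (D F ι₁ V Φ).cmType (AlgHom.id ℚ F))) B ιB θB := by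
  intro F _ h6 Φ ι₁ hι V Dμ e he
  exact exists_isogeny_isCMTypeRealisation_baseChange_of_det45 hW hdetBC (σ F ι₁ V Φ) (D F ι₁ V Φ).isConjugateSymplectic
    (Aμ₀ F ι₁ V Φ Dμ) (iμ₀ F ι₁ V Φ Dμ) (hdim F h6 Φ ι₁ hι V Dμ) (hdet45σ F h6 Φ ι₁ hι V Dμ) e he

/-- **`hCMisogσ` from [Liu2021] Def. 4.5 (2) — Liu DATA readings ONLY, σ-parametric pin**: the previous theorem with
`hW := cotangent_hodge10_comparison_holds` (TEAM hCMisogE TRACK 2, p302876) and `hdetBC := Model.det_cotangentMap_baseChange_law` (b17,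
p302504).  After it the CM side of the ALONG display carries the carrier `iμ₀` and the readings `hdim`/`hdet45σ` — nothing else.
HC_CM is NOT proved. [cite: Liu2021, Def. 4.5 (1)–(2) (FJcycle.tex ll. 1939–1951) and Prop. 4.6 (1) (l. 1969)]
[cite: Shimura1998, §5.2 (pp. 36–37) and §7.1 Prop. 7 (p. 47)] [cite: LangeBirkenhake1992, §1.1 (1.6) and Theorem 1.1.21] -/
theorem hCMisogσ_of_liu45
    (D : ∀ (F : CMField) (ι₁ : F →+* ℂ) (_ : HermSpace3 F ι₁) (_ : CMType F), Thm418Data (maximalRealSubfield F) F)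
    (σ : ∀ (F : CMField) (ι₁ : F →+* ℂ) (_ : HermSpace3 F ι₁) (_ : CMType F), F →+* ℂ)
    (Aμ₀ : ∀ (F : CMField) (ι₁ : F →+* ℂ) (V : HermSpace3 F ι₁) (Φ : CMType F), (D F ι₁ V Φ).Obj → AbelianVariety F)
    (iμ₀ : ∀ (F : CMField) (ι₁ : F →+* ℂ) (V : HermSpace3 F ι₁) (Φ : CMType F) (Dμ : (D F ι₁ V Φ).Obj),
      muAlgValueField F (D F ι₁ V Φ).μ →+* (Aμ₀ F ι₁ V Φ Dμ).endAlgebra)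
    (hdim : ∀ (F : CMField) [IsGalois ℚ F], 6 ≤ Module.finrank ℚ F → ∀ (Φ : CMType F) (ι₁ : F →+* ℂ), ι₁ ∈ Φ.1 →
      ∀ (V : HermSpace3 F ι₁) (Dμ : (D F ι₁ V Φ).Obj),
        Module.finrank ℚ (muAlgValueField F (D F ι₁ V Φ).μ) = 2 * (Aμ₀ F ι₁ V Φ Dμ).dim)
    (hdet45σ : ∀ (F : CMField) [IsGalois ℚ F], 6 ≤ Module.finrank ℚ F → ∀ (Φ : CMType F) (ι₁ : F →+* ℂ), ι₁ ∈ Φ.1 →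
      ∀ (V : HermSpace3 F ι₁) (Dμ : (D F ι₁ V Φ).Obj) (x : muAlgValueField F (D F ι₁ V Φ).μ) (M : ℕ)
        (f : End (Aμ₀ F ι₁ V Φ Dμ)), M ≠ 0 →
        iμ₀ F ι₁ V Φ Dμ x =
          algebraMap ℚ (Aμ₀ F ι₁ V Φ Dμ).endAlgebra (M : ℚ)⁻¹ * AbelianVariety.endAlgebra.of (Aμ₀ F ι₁ V Φ Dμ) f →
        LinearMap.det (AbelianVariety.cotangentMap (Aμ₀ F ι₁ V Φ Dμ) f) =
          (M : F) ^ (Aμ₀ F ι₁ V Φ Dμ).dim * Def45.eta (AlgHom.id ℚ F) (σ F ι₁ V Φ) (D F ι₁ V Φ).isConjugateSymplectic x) :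
    ∀ (F : CMField) [IsGalois ℚ F], 6 ≤ Module.finrank ℚ F → ∀ (Φ : CMType F) (ι₁ : F →+* ℂ), ι₁ ∈ Φ.1 →
      ∀ (V : HermSpace3 F ι₁) (Dμ : (D F ι₁ V Φ).Obj),
        haveI := (D F ι₁ V Φ).isConjugateSymplectic.numberField_muAlgValueField
        ∀ e : reflexField ℚ F (algValuedIn (σ F ι₁ V Φ) (D F ι₁ V Φ).cmType.1) →+* muAlgValueField F (D F ι₁ V Φ).μ,
          (∀ k : reflexField ℚ F (algValuedIn (σ F ι₁ V Φ) (D F ι₁ V Φ).cmType.1),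
            ((e k : muAlgValueField F (D F ι₁ V Φ).μ) : ℂ) = σ F ι₁ V Φ k) →
          ∃ (B : AbelianVariety ℂ) (g : (letI := (σ F ι₁ V Φ).toAlgebra; (Aμ₀ F ι₁ V Φ Dμ).baseChange ℂ) ⟶ B),
            AbelianVariety.IsIsogeny g ∧
            ∃ (ιB : 𝓞 (muAlgValueField F (D F ι₁ V Φ).μ) →+* End B)
              (θB : muAlgValueField F (D F ι₁ V Φ).μ →+* Module.End ℂ (complexBetti B.X 1)),
              IsCMTypeRealisation (inducedCMType e (reflexCMType (σ F ι₁ V Φ) (D F ι₁ V Φ).cmType (AlgHom.id ℚ F))) B ιB θB :=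
  hCMisogσ_of_det45 cotangent_hodge10_comparison_holds det_cotangentMap_baseChange_law D σ Aμ₀ iμ₀ hdim hdet45σ

/-- **`hCMisogσ` AT THE PACKAGE-P2′ PIN `σ := conj ∘ ι₁`, from the RECORD readings of [Liu2021] Def. 4.5 (2) through `ι₁`.**
EXACTLY the binder `hCMisogσ` of pin-2's along-junction `Model.faceSupply_of_thm418AsPrinted_pinned_isog_along` instantiated at
`σ := fun _ ι₁ _ _ => (starRingEnd ℂ).comp ι₁` (the pin along which TEAM hComp delivers `hComp`/`hUnif`/`hAlb`; b28 §T20), from the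
SAME carriers `D`, `Aμ₀`, `iμ₀` and the SAME two readings `hdim`, `hdet45` (FIRST BULLET through `ι₁`, = `Def45.CMDatum.det45` body with
`Def45.eta (AlgHom.id ℚ F) ι₁`) that feed the `ι₁`-pinned displays `Item6SupplyPinnedDef45*.lean` — because Liu's `η_μ` does not see the
choice between `ι₁` and `conj ∘ ι₁`: hcomp-abcm-2's `Def45.eta_starRingEnd_comp_apply` (`Literature/NumberTheory/Automorphic/Liu2021/Def45EtaConjugate.lean`,
p306543; READING I1-R1 of `Def45AsPrinted` proved for this pair — `conjGal` is central in `Gal(F/ℚ)`).  So ONE set of Liu-data readings serves both the record display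
and the joint (P2′) display.  HC_CM is NOT proved; `hdim`/`hdet45` are inhabited exactly by an object of `𝒜(μ)` ([Liu2021] Prop. 4.6 (1)).
[cite: Liu2021, Def. 4.5 (1)–(2) (FJcycle.tex ll. 1939–1951), Remark 4.4 (ll. 1930–1933) and Prop. 4.6 (1) (l. 1969)]
[cite: Shimura1998, §5.2 (pp. 36–37), §7.1 Prop. 7 (p. 47) and §8.3 Prop. 28] -/
theorem hCMisogσ_conj_of_liu45
    (D : ∀ (F : CMField) (ι₁ : F →+* ℂ) (_ : HermSpace3 F ι₁) (_ : CMType F), Thm418Data (maximalRealSubfield F) F)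
    (Aμ₀ : ∀ (F : CMField) (ι₁ : F →+* ℂ) (V : HermSpace3 F ι₁) (Φ : CMType F), (D F ι₁ V Φ).Obj → AbelianVariety F)
    (iμ₀ : ∀ (F : CMField) (ι₁ : F →+* ℂ) (V : HermSpace3 F ι₁) (Φ : CMType F) (Dμ : (D F ι₁ V Φ).Obj),
      muAlgValueField F (D F ι₁ V Φ).μ →+* (Aμ₀ F ι₁ V Φ Dμ).endAlgebra)
    (hdim : ∀ (F : CMField) [IsGalois ℚ F], 6 ≤ Module.finrank ℚ F → ∀ (Φ : CMType F) (ι₁ : F →+* ℂ), ι₁ ∈ Φ.1 →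
      ∀ (V : HermSpace3 F ι₁) (Dμ : (D F ι₁ V Φ).Obj),
        Module.finrank ℚ (muAlgValueField F (D F ι₁ V Φ).μ) = 2 * (Aμ₀ F ι₁ V Φ Dμ).dim)
    (hdet45 : ∀ (F : CMField) [IsGalois ℚ F], 6 ≤ Module.finrank ℚ F → ∀ (Φ : CMType F) (ι₁ : F →+* ℂ), ι₁ ∈ Φ.1 →
      ∀ (V : HermSpace3 F ι₁) (Dμ : (D F ι₁ V Φ).Obj) (x : muAlgValueField F (D F ι₁ V Φ).μ) (M : ℕ)
        (f : End (Aμ₀ F ι₁ V Φ Dμ)), M ≠ 0 →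
        iμ₀ F ι₁ V Φ Dμ x =
          algebraMap ℚ (Aμ₀ F ι₁ V Φ Dμ).endAlgebra (M : ℚ)⁻¹ * AbelianVariety.endAlgebra.of (Aμ₀ F ι₁ V Φ Dμ) f →
        LinearMap.det (AbelianVariety.cotangentMap (Aμ₀ F ι₁ V Φ Dμ) f) =
          (M : F) ^ (Aμ₀ F ι₁ V Φ Dμ).dim * Def45.eta (AlgHom.id ℚ F) ι₁ (D F ι₁ V Φ).isConjugateSymplectic x) :
    ∀ (F : CMField) [IsGalois ℚ F], 6 ≤ Module.finrank ℚ F → ∀ (Φ : CMType F) (ι₁ : F →+* ℂ), ι₁ ∈ Φ.1 →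
      ∀ (V : HermSpace3 F ι₁) (Dμ : (D F ι₁ V Φ).Obj),
        haveI := (D F ι₁ V Φ).isConjugateSymplectic.numberField_muAlgValueField
        ∀ e : reflexField ℚ F (algValuedIn ((starRingEnd ℂ).comp ι₁) (D F ι₁ V Φ).cmType.1) →+* muAlgValueField F (D F ι₁ V Φ).μ,
          (∀ k : reflexField ℚ F (algValuedIn ((starRingEnd ℂ).comp ι₁) (D F ι₁ V Φ).cmType.1),
            ((e k : muAlgValueField F (D F ι₁ V Φ).μ) : ℂ) = (starRingEnd ℂ).comp ι₁ k) →
          ∃ (B : AbelianVariety ℂ) (g : (letI := ((starRingEnd ℂ).comp ι₁).toAlgebra; (Aμ₀ F ι₁ V Φ Dμ).baseChange ℂ) ⟶ B),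
            AbelianVariety.IsIsogeny g ∧
            ∃ (ιB : 𝓞 (muAlgValueField F (D F ι₁ V Φ).μ) →+* End B)
              (θB : muAlgValueField F (D F ι₁ V Φ).μ →+* Module.End ℂ (complexBetti B.X 1)),
              IsCMTypeRealisation (inducedCMType e (reflexCMType ((starRingEnd ℂ).comp ι₁) (D F ι₁ V Φ).cmType (AlgHom.id ℚ F))) B ιB θB :=
  hCMisogσ_of_liu45 D (fun _ ι₁ _ _ => (starRingEnd ℂ).comp ι₁) Aμ₀ iμ₀ hdim
    fun F _ h6 Φ ι₁ hι V Dμ x M f hM hx => by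
      rw [Def45.eta_starRingEnd_comp_apply]
      exact hdet45 F h6 Φ ι₁ hι V Dμ x M f hM hx

end Summit.HodgeConjecture.CorCM.Model

end
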